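import Summits.CriticalPhenomena.Ising3D.TaylorOddConeEulerMajorant
import Summits.CriticalPhenomena.Ising3D.TaylorRegionKernel
import Mathlib.Tactic.Linarith
import Mathlib.Tactic.Positivity
import Mathlib.Tactic.Ring
import HarnessLib

/-!
# The `(E, h_k)`-polynomial form of a weighted q-sum from a kernel expansion (Legendre-free)
(cell `pub-ising3x`, seat recog-1 gen 10; the link between boot-1's two-variable kernel `evenKernel` and the
`(E - c)^m h_k(j)` basis in which experiment M-g1 imposed and priced the odd cone — supplies the hypothesis
`hexp` of `qM_half_of_eulerDomination`, so obligation (M) becomes a FINITE coefficient-domination check)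

HONEST FRAMING: lottery ticket; floor = tightest certified 3D Ising CFT bounds; no exact-solution
claim without a proof.

At the antidiagonal point `p₁ + p₂ = j` the kernel arguments are `u = (E-j)/2 + p₁`, `v = (E-j)/2 + p₂`, so
`u + v = E` and `u - v = p₁ - p₂`. Hence if the (polynomial) kernel is written in the variables
`(u + v - c, u - v)` — `K(u,v) = Σ_{(m,k)∈T} κ(m,k) (u+v-c)^m (u-v)^{2k} + Σ_{(m,k)∈T'} κ'(m,k) (u+v-c)^m (u-v)^{2k+1}`
(a finite identity a table establishes by ring arithmetic for its functional) — then
`qSum c S s σ E j = Σ_{(m,k)∈T} κ(m,k) (E-c)^m hMoment k j` EXACTLY (`qSum_eq_sum_hMoment_of_kernel`): the odd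
powers of `p₁ - p₂` average to zero against the symmetric weights `λ_{p₁}λ_{p₂}` (`sum_antidiagonal_lam_odd_pow`),
the even ones are the moments `hMoment k j ≥ 0` of recog-1 g9. No Legendre-polynomial identity is used; `h_k(j)`
as a polynomial in `J = j(j+1)` is NOT needed for the cone obligations (only `h_k ≥ 0` and this expansion are).
Corollary `qM_half_of_kernelExpansion`: (M̂) for the shifted Euler–rapidity majorant `Ψ_u` from the kernel
expansion of the row-3 component and `|(½)^{Δσ+Δε} κ₃| ≤ u` coefficientwise. Elementary (finite sums).
-/

namespace Summit.CriticalPhenomena.Ising3D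

open Finset Set
open Literature.MathematicalPhysics.QuantumFieldTheory.ConformalBootstrap3D

/-- **Odd moments of the antidiagonal vanish**: `Σ_{p₁+p₂=j} λ_{p₁}λ_{p₂} (p₁-p₂)^{2k+1} = 0` (swap symmetry).
[folklore] -/
theorem sum_antidiagonal_lam_odd_pow (k j : ℕ) :
    ∑ p ∈ antidiagonal j, legendreLam p.1 * legendreLam p.2 * ((p.1 : ℝ) - p.2) ^ (2 * k + 1) = 0 := by
  have h : ∑ p ∈ antidiagonal j, legendreLam p.1 * legendreLam p.2 * ((p.1 : ℝ) - p.2) ^ (2 * k + 1) =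
      -∑ p ∈ antidiagonal j, legendreLam p.1 * legendreLam p.2 * ((p.1 : ℝ) - p.2) ^ (2 * k + 1) := by
    conv_lhs => rw [← Nat.sum_antidiagonal_swap]
    rw [← Finset.sum_neg_distrib]
    refine Finset.sum_congr rfl fun p _ => ?_
    simp only [Prod.fst_swap, Prod.snd_swap]
    have hodd : ((p.2 : ℝ) - p.1) ^ (2 * k + 1) = -(((p.1 : ℝ) - p.2) ^ (2 * k + 1)) := by
      rw [show (p.2 : ℝ) - p.1 = -((p.1 : ℝ) - p.2) by ring, Odd.neg_pow ⟨k, rfl⟩]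
    rw [hodd]
    ring
  linarith

/-- **The `(E, h_k)` form of a q-sum from a kernel expansion** (module docstring). [folklore] -/
theorem qSum_eq_sum_hMoment_of_kernel (c : ℕ × ℕ → ℝ) (S : Finset (ℕ × ℕ)) (s σ cc : ℝ)
    (T T' : Finset (ℕ × ℕ)) (κ κ' : ℕ × ℕ → ℝ)
    (hK : ∀ u v : ℝ, evenKernel c S s σ u v =
      ∑ mk ∈ T, κ mk * ((u + v - cc) ^ mk.1 * (u - v) ^ (2 * mk.2)) +
        ∑ mk ∈ T', κ' mk * ((u + v - cc) ^ mk.1 * (u - v) ^ (2 * mk.2 + 1)))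
    (E : ℝ) (j : ℕ) :
    qSum c S s σ E j = ∑ mk ∈ T, κ mk * ((E - cc) ^ mk.1 * hMoment mk.2 j) := by
  rw [qSum_eq_sum_evenKernel]
  have hpt : ∀ p ∈ antidiagonal j,
      (E - (j : ℝ)) / 2 + p.1 + ((E - (j : ℝ)) / 2 + p.2) - cc = E - cc ∧
        (E - (j : ℝ)) / 2 + p.1 - ((E - (j : ℝ)) / 2 + p.2) = (p.1 : ℝ) - p.2 := by
    intro p hp
    have : (p.1 : ℝ) + p.2 = j := by exact_mod_cast mem_antidiagonal.mp hp
    constructor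
    · linarith
    · ring
  calc ∑ p ∈ antidiagonal j, legendreLam p.1 * legendreLam p.2 *
          evenKernel c S s σ ((E - (j : ℝ)) / 2 + p.1) ((E - (j : ℝ)) / 2 + p.2)
      = ∑ p ∈ antidiagonal j, legendreLam p.1 * legendreLam p.2 *
          (∑ mk ∈ T, κ mk * ((E - cc) ^ mk.1 * ((p.1 : ℝ) - p.2) ^ (2 * mk.2)) +
            ∑ mk ∈ T', κ' mk * ((E - cc) ^ mk.1 * ((p.1 : ℝ) - p.2) ^ (2 * mk.2 + 1))) := by
        refine Finset.sum_congr rfl fun p hp => ?_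
        rw [hK, (hpt p hp).1, (hpt p hp).2]
    _ = ∑ p ∈ antidiagonal j, ∑ mk ∈ T, κ mk * (E - cc) ^ mk.1 *
            (legendreLam p.1 * legendreLam p.2 * ((p.1 : ℝ) - p.2) ^ (2 * mk.2)) +
        ∑ p ∈ antidiagonal j, ∑ mk ∈ T', κ' mk * (E - cc) ^ mk.1 *
            (legendreLam p.1 * legendreLam p.2 * ((p.1 : ℝ) - p.2) ^ (2 * mk.2 + 1)) := by
        rw [← Finset.sum_add_distrib]
        refine Finset.sum_congr rfl fun p _ => ?_
        rw [mul_add, Finset.mul_sum, Finset.mul_sum]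
        congr 1 <;> exact Finset.sum_congr rfl fun mk _ => by ring
    _ = ∑ mk ∈ T, κ mk * (E - cc) ^ mk.1 *
            ∑ p ∈ antidiagonal j, legendreLam p.1 * legendreLam p.2 * ((p.1 : ℝ) - p.2) ^ (2 * mk.2) +
        ∑ mk ∈ T', κ' mk * (E - cc) ^ mk.1 *
            ∑ p ∈ antidiagonal j, legendreLam p.1 * legendreLam p.2 * ((p.1 : ℝ) - p.2) ^ (2 * mk.2 + 1) := by
        rw [Finset.sum_comm, Finset.sum_comm (s := antidiagonal j)]
        congr 1 <;> exact Finset.sum_congr rfl fun mk _ => by rw [Finset.mul_sum]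
    _ = ∑ mk ∈ T, κ mk * ((E - cc) ^ mk.1 * hMoment mk.2 j) := by
        have h0 : ∑ mk ∈ T', κ' mk * (E - cc) ^ mk.1 *
            ∑ p ∈ antidiagonal j, legendreLam p.1 * legendreLam p.2 * ((p.1 : ℝ) - p.2) ^ (2 * mk.2 + 1) = 0 :=
          Finset.sum_eq_zero fun mk _ => by rw [sum_antidiagonal_lam_odd_pow, mul_zero]
        rw [h0, add_zero]
        exact Finset.sum_congr rfl fun mk _ => by rw [hMoment]; ring

/-- **(M̂) for `Ψ_u` from a kernel expansion of the row-3 component and coefficient domination.** If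
`evenKernel (w 2) S s̄ (-1)` has the expansion with coefficient tables `κ` (even powers, on `T`) and `κ'` (odd),
`m + 2k ≤ N` on `T`, `|(½)^{Δσ+Δε} κ| ≤ u` on `T`, then at every `(E, j)` with `E ≥ c`, `j ≤ E` the hypothesis
`hM` of `oddConeAt_half_of_qCone` holds for the majorant weights `eulerMajorantWeight ½ c T u`. [folklore] -/
theorem qM_half_of_kernelExpansion (S : Finset (ℕ × ℕ)) (w : Fin 5 → ℕ × ℕ → ℝ) (Δσ Δε c : ℝ)
    {N : ℕ} (T T' : Finset (ℕ × ℕ)) (hT : ∀ mk ∈ T, mk.1 + 2 * mk.2 ≤ N) (κ κ' u : ℕ × ℕ → ℝ)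
    (hK : ∀ u' v' : ℝ, evenKernel (w 2) S ((Δσ + Δε) / 2) (-1) u' v' =
      ∑ mk ∈ T, κ mk * ((u' + v' - c) ^ mk.1 * (u' - v') ^ (2 * mk.2)) +
        ∑ mk ∈ T', κ' mk * ((u' + v' - c) ^ mk.1 * (u' - v') ^ (2 * mk.2 + 1)))
    (hdom : ∀ mk ∈ T, |(1 / 2 : ℝ) ^ (Δσ + Δε) * κ mk| ≤ u mk) {E : ℝ} {j : ℕ} (hEj : (j : ℝ) ≤ E)
    (hcE : c ≤ E) :
    (1 / 2 : ℝ) ^ (Δσ + Δε) * |qSum (w 2) S ((Δσ + Δε) / 2) (-1) E j| ≤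
      qSum (eulerMajorantWeight (1 / 2) c T u) (eulerIndexSet N) 0 0 E j := by
  refine qM_half_of_eulerDomination S w c hT u (fun mk => (1 / 2 : ℝ) ^ (Δσ + Δε) * κ mk) Δσ Δε E j
    hEj hcE ?_ hdom
  rw [qSum_eq_sum_hMoment_of_kernel (w 2) S ((Δσ + Δε) / 2) (-1) c T T' κ κ' hK E j, Finset.mul_sum]
  exact Finset.sum_congr rfl fun mk _ => by ring

end Summit.CriticalPhenomena.Ising3D
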